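import Summits.CriticalPhenomena.PercolationContinuityZ3.Theorems.PercNearOneGluingNoHeavyQuantStepFSSure
import Summits.CriticalPhenomena.PercolationContinuityZ3.Theorems.PercNearOneGluingNoHeavyQuantDIBStarFloorSplitInductionBig
import HarnessLib

/-!
# QUANT lane R8, Conjecture DIB\* — the floor-split step lemma NARROWED TO ITS CORE (lead g18): no dead light, light total `≥ j + 1`,
# and the largest blob NOT sure; `StepLemmaFSCore ↔ ∀ x < 1, DIBStar x`

builds on p205010 (kernel theorem, internal audit signed; external expert review pending)

Statement + support file (`--supports stmt-CriticalPhenomena-4575`), QUANT lane lead (gen 18); memo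
`run/shared/lean/prim/quant/prim-quant-lead-g18/LEAD-NOTES-G18.md` N35.  ONE `Prop` definition (the `@[conjecture]` `StepLemmaFSCore`), theorems
otherwise; no sorries, standard axioms.

`…QuantDIBStarFloorSplitInduction` (lead g17, p259002) proved `StepLemmaFS ↔ ∀ x < 1, DIBStar x` by a strong induction on the total size in
which dead lights (rate `κ_z(g) ≤ 0`, i.e. `g ≤ z²`) are shrunk to size `0` BEFORE the step is invoked — but the typed step did not record
it; `…FloorSplitInductionBig` (p260228) removed small light clouds (census-1 g15); `…QuantStepFSSure` (lead g18) PROVED the step when the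
largest blob is sure.  This file re-runs the induction once and hands all three facts to the step:

* `Quant.IndepBlob.StepLemmaFSCore` (`@[conjecture]`) — `StepLemmaFSBig` with two more hypotheses: every non-empty light blob has
  `x² < g` (NO DEAD LIGHT), and NO blob of maximal size is sure (`(∀ i, a i ≤ a k) → g k < 1`).
* **`Quant.RootDec.cappedRows_of_stepLemmaFSCore`** — the induction of p259002 verbatim, whose hard case now dispatches small clouds to
  `IndepBlob.dibStar_of_lightTotal_le`, a sure largest blob to `RootDec.stepFS_sure`, and records `x² < g` from the shrinking.
* **`Quant.IndepBlob.stepLemmaFSCore_iff_dibStar : StepLemmaFSCore ↔ ∀ x < 1, DIBStar x`.**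

So the OPEN CLASS of T-DIB is now exactly: `1/2 < x < 1`; all sizes `≤ j`; heavy total `≤ 2j`; at least two non-empty light blobs, every
non-empty light with `x² < g < x`, light total `≥ j + 1`; discounted credit `> 2j`; THE LARGEST BLOB HAS GATE `< 1` (type H: `x ≤ g < 1`,
or type L: light) — given the capped rows of every one-blob deletion.  [this work]; the gluing rows served [cite: KozmaNitzan2024, Conjecture 3 (p. 15)].
-/

namespace Summit.CriticalPhenomena.PercolationContinuityZ3.Theorems

namespace Quant

namespace IndepBlob

open Finset

/-- **CONJECTURE — the floor-split step lemma on its CORE class** (lead g18): `StepLemmaFSBig` (`…FloorSplitInductionBig`) restricted to hard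
instances with NO DEAD LIGHT (`g k < x`, `0 < a k` ⟹ `x² < g k`) and NO SURE BLOB OF MAXIMAL SIZE (`(∀ i, a i ≤ a k) ⟹ g k < 1`).  Equivalent to
`∀ x < 1, DIBStar x` (`stepLemmaFSCore_iff_dibStar`).  Evidence: that of `StepLemmaFS` (4.5 M exact hard instances, 0 failures of the single
floor split on the largest blob; kit j128350/1/3/4, j129614).  builds on p205010 (kernel theorem, internal audit signed; external expert review
pending). [this work] [status: open] -/
@[conjecture] def StepLemmaFSCore : Prop :=
  ∀ (κ : Type) [Fintype κ] [DecidableEq κ] (a : κ → ℕ) (g : κ → ℝ) (j : ℕ) (x : ℝ),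
    1 / 2 < x → x < 1 →
    (∀ k, 0 ≤ g k ∧ g k ≤ 1) →
    (∀ k, g k < x → a k ≤ j) →
    (∑ k ∈ Finset.univ.filter (fun k => x ≤ g k), a k ≤ 2 * j) →
    (∀ k, x ≤ g k → a k ≤ j) →
    (∃ k₁ k₂, k₁ ≠ k₂ ∧ g k₁ < x ∧ 0 < a k₁ ∧ g k₂ < x ∧ 0 < a k₂) →
    (j + 1 ≤ ∑ k ∈ Finset.univ.filter (fun k => g k < x), a k) →
    (∀ k, g k < x → 0 < a k → x ^ 2 < g k) →
    (∀ k, (∀ i, a i ≤ a k) → g k < 1) →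
    (2 * j : ℝ) < ∑ k, (a k : ℝ) * (if x ≤ g k then g k else (g k - x ^ 2) / (1 - x)) →
    (∀ k, 0 < a k → RootDec.CappedRows (Function.update a k 0) g) →
    x ≤ ∑ W : Finset κ, (∏ k, if k ∈ W then g k else 1 - g k) * (if j + 1 ≤ ∑ k ∈ W, a k then (1 : ℝ) else 0)

/-- The core step lemma follows from DIB\* below one. [this work] -/
theorem stepLemmaFSCore_of_dibStar (h : ∀ x : ℝ, x < 1 → DIBStar x) : StepLemmaFSCore :=
  fun κ _ _ a g j x _ hx1 hg hlight _ _ _ _ _ _ hcredit _ => h x hx1 κ a g j hg hlight hcredit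

end IndepBlob

namespace RootDec

open Finset

variable {κ : Type*} [Fintype κ] [DecidableEq κ]

/-- product-Bernoulli weight of the set `W` of open blobs (as in `…QuantRootReduction`) -/
local notation3 "wt[" g ", " W "]" => ∏ k, (if k ∈ (W : Finset κ) then (g : κ → ℝ) k else 1 - (g : κ → ℝ) k)

/-- the TERM tail `P(s + Σ_{k open} a k ≥ j+1)` (as in `…QuantRootReduction`) -/
local notation3 "TERM[" s ", " a ", " g ", " j "]" =>
  ∑ W : Finset κ, wt[g, W] * (if (j : ℕ) + 1 ≤ (s : ℕ) + ∑ k ∈ W, (a : κ → ℕ) k then (1 : ℝ) else 0)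

/-- **THE FLOOR-SPLIT INDUCTION, CORE FORM: `StepLemmaFSCore ⟹` the capped row of EVERY finite system at every floor `< 1`.**
The induction of `cappedRows_of_stepLemmaFS` (p259002) verbatim; in the hard case small light clouds go to `IndepBlob.dibStar_of_lightTotal_le`
(census-1 g15), a sure largest blob to `RootDec.stepFS_sure` (lead g18), and the shrinking supplies `x² < g` for every non-empty light. [this work] -/
theorem cappedRows_of_stepLemmaFSCore (H : IndepBlob.StepLemmaFSCore) {κ : Type} [Fintype κ] [DecidableEq κ] (a : κ → ℕ)
    (g : κ → ℝ) (hg : ∀ k, 0 ≤ g k ∧ g k ≤ 1) : CappedRows a g := by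
  suffices main : ∀ (A : ℕ) {κ : Type} [Fintype κ] [DecidableEq κ] (a : κ → ℕ) (g : κ → ℝ),
      (∀ k, 0 ≤ g k ∧ g k ≤ 1) → ∑ k, a k ≤ A → CappedRows a g from main _ a g hg le_rfl
  intro A
  induction A using Nat.strong_induction_on with
  | _ A ih =>
  intro κ _ _ a g hg hA z s j hz1 hbudget
  -- floors ≤ 1/2: lead g15's discounted Cantelli (capped form, typer g17)
  by_cases hhalf : z ≤ 1 / 2
  · exact term_ge_of_credit_of_le_half s a g j z hhalf hg hbudget
  have hzhalf : 1 / 2 < z := not_le.1 hhalf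
  -- a sure part ≥ j+1 decides
  by_cases hsure : j + 1 ≤ s
  · rw [term_eq_one_of_sure s a g j hsure]; exact hz1.le
  have hsj : s ≤ j := by omega
  have h1z : (0 : ℝ) < 1 - z := by linarith
  -- shrink the light giants (as in `term_ge_of_dibWith_capped`)
  set a' : κ → ℕ := fun k => if z ≤ g k then a k else
    (if 0 < (g k - z ^ 2) / (1 - z) then min (a k) (j - s) else 0) with ha'
  have hle : ∀ k, a' k ≤ a k := by
    intro k
    simp only [ha']
    split_ifs
    · exact le_refl _
    · exact Nat.min_le_left _ _
    · exact Nat.zero_le _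
  have hA' : ∑ k, a' k ≤ A := (Finset.sum_le_sum fun k _ => hle k).trans hA
  have hheavy' : ∀ k, z ≤ g k → a' k = a k := fun k hk => by simp only [ha']; rw [if_pos hk]
  have hlight' : ∀ k, g k < z → a' k ≤ j - s := by
    intro k hk
    simp only [ha']
    rw [if_neg (not_le.2 hk)]
    split_ifs
    · exact Nat.min_le_right _ _
    · exact Nat.zero_le _
  -- NEW (lead g18): the shrunk system has no dead light
  have hposz : ∀ k, g k < z → 0 < a' k → z ^ 2 < g k := by
    intro k hk hpos
    simp only [ha'] at hpos
    rw [if_neg (not_le.2 hk)] at hpos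
    by_cases hκ : 0 < (g k - z ^ 2) / (1 - z)
    · have := (div_pos_iff_of_pos_right h1z).1 hκ
      linarith
    · rw [if_neg hκ] at hpos; exact absurd hpos (lt_irrefl 0)
  -- the (uncapped) discounted credit of the shrunk system
  have hterm : ∀ k, (if z ≤ g k then (a k : ℝ) * g k else ((min (a k) (j - s) : ℕ) : ℝ) * max ((g k - z ^ 2) / (1 - z)) 0) =
      (a' k : ℝ) * (if z ≤ g k then g k else (g k - z ^ 2) / (1 - z)) := by
    intro k
    by_cases hk : z ≤ g k
    · rw [if_pos hk, if_pos hk, hheavy' k hk]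
    · rw [if_neg hk, if_neg hk]
      simp only [ha']
      rw [if_neg hk]
      by_cases hpos : 0 < (g k - z ^ 2) / (1 - z)
      · rw [if_pos hpos, max_eq_left hpos.le]
      · rw [if_neg hpos, max_eq_right (not_lt.1 hpos), Nat.cast_zero, mul_zero, zero_mul]
  have hcredit' : (2 * ((j - s : ℕ) : ℝ)) < ∑ k, (a' k : ℝ) * (if z ≤ g k then g k else (g k - z ^ 2) / (1 - z)) := by
    rw [← Finset.sum_congr rfl fun k _ => hterm k, Nat.cast_sub hsj]
    linarith
  refine le_trans ?_ (term_mono_sizes s a' a g j hg hle)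
  -- heavy sizes reaching the odd threshold: the size row with extras
  by_cases hbig : 2 * (j - s) + 1 ≤ ∑ k ∈ Finset.univ.filter (fun k => z ≤ g k), a' k
  · exact term_ge_of_extraBlobs s a' g j z hzhalf.le hz1.le hg hbig
  have hcorner : ∑ k ∈ Finset.univ.filter (fun k => z ≤ g k), a' k ≤ 2 * (j - s) := by omega
  -- a heavy giant decides
  by_cases hgiant : ∃ k, z ≤ g k ∧ j + 1 ≤ s + a' k
  · obtain ⟨k, hzk, hk⟩ := hgiant
    exact hzk.trans (gate_le_term_of_giant s a' g j hg k hk)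
  have hnogiant : ∀ k, z ≤ g k → a' k ≤ j - s := by
    intro k hk
    by_contra hcon
    exact hgiant ⟨k, hk, by omega⟩
  -- no non-empty light blob: FAR for independent blobs with a sure shift
  by_cases hpres : ∃ k, g k < z ∧ 0 < a' k
  swap
  · have hzero : ∀ k, g k < z → a' k = 0 := fun k hk => Nat.eq_zero_of_not_pos fun hpos => hpres ⟨k, hk, hpos⟩
    have hbudget'' : (2 * j : ℝ) < 2 * s + ∑ k, (a' k : ℝ) * g k := by
      have hsum : ∑ k, (a' k : ℝ) * (if z ≤ g k then g k else (g k - z ^ 2) / (1 - z)) = ∑ k, (a' k : ℝ) * g k := by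
        refine Finset.sum_congr rfl fun k _ => ?_
        by_cases hk : z ≤ g k
        · rw [if_pos hk]
        · rw [if_neg hk, hzero k (not_le.1 hk), Nat.cast_zero, zero_mul, zero_mul]
      rw [← hsum]
      have : (2 * ((j - s : ℕ) : ℝ)) = 2 * j - 2 * s := by rw [Nat.cast_sub hsj]; ring
      linarith
    exact term_ge_of_budget s a' g j z hz1.le hg (fun k hk => not_lt.1 fun h' => hk (hzero k h')) hbudget''
  obtain ⟨ℓ, hℓ, hℓa⟩ := hpres
  rw [term_shift s a' g j hsj]
  by_cases huniq : ∀ k, g k < z → 0 < a' k → k = ℓ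
  · -- exactly one non-empty light blob: census-1 g14 / typer g18
    exact IndepBlob.dibStarCorner_of_oneLight hzhalf.le hz1 a' g (j - s) hg hlight' hcorner ℓ hℓ hℓa huniq hcredit'
  push Not at huniq
  obtain ⟨k₂, hk₂, hk₂a, hk₂ℓ⟩ := huniq
  -- the induction hypothesis for every one-blob-deleted sub-system
  have ih' : ∀ k, 0 < a' k → CappedRows (Function.update a' k 0) g :=
    fun k hk => ih _ (lt_of_lt_of_le (sum_update_zero_lt a' k hk) hA') _ g hg le_rfl
  -- NEW (census-1 g15 via lead g17's Big): small light clouds are kernel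
  by_cases hsmall : ∑ k ∈ Finset.univ.filter (fun k => g k < z), a' k ≤ j - s
  · exact IndepBlob.dibStar_of_lightTotal_le z (by linarith) hz1 a' g (j - s) hg hsmall hcredit'
  -- NEW (lead g18): a sure blob of maximal size is a theorem
  by_cases hsureMax : ∃ k, g k = 1 ∧ ∀ i, a' i ≤ a' k
  · obtain ⟨k, hk1, hmax⟩ := hsureMax
    exact stepFS_sure a' g (j - s) z hzhalf hz1 hg hnogiant (fun i hi hpos => (hposz i hi hpos).le) hcredit' ih' k hk1 hmax
  have hcore : ∀ k, (∀ i, a' i ≤ a' k) → g k < 1 := by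
    intro k hmax
    rcases lt_or_eq_of_le (hg k).2 with h | h
    · exact h
    · exact absurd ⟨k, h, hmax⟩ hsureMax
  -- the hard CORE case: the step lemma, fed with the induction hypothesis
  exact H κ a' g (j - s) z hzhalf hz1 hg hlight' hcorner hnogiant ⟨k₂, ℓ, hk₂ℓ, hk₂, hk₂a, hℓ, hℓa⟩ (by omega) hposz hcore
    hcredit' ih'

end RootDec

namespace IndepBlob

/-- **`StepLemmaFSCore ⟹ DIB\*` at every floor `x < 1`.** [this work] -/
theorem dibStar_of_stepLemmaFSCore (H : StepLemmaFSCore) (x : ℝ) (hx1 : x < 1) : DIBStar x := by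
  intro ι _ _ a g j hg hlight hcredit
  have hC := RootDec.cappedRows_of_stepLemmaFSCore H a g hg
  have hbudget : (2 * j : ℝ) < 2 * ((0 : ℕ) : ℝ) + ∑ k, (if x ≤ g k then (a k : ℝ) * g k
      else ((min (a k) (j - 0) : ℕ) : ℝ) * max ((g k - x ^ 2) / (1 - x)) 0) := by
    rw [Nat.cast_zero, mul_zero, zero_add]
    refine hcredit.trans_le (Finset.sum_le_sum fun k _ => ?_)
    by_cases hk : x ≤ g k
    · rw [if_pos hk, if_pos hk]
    · rw [if_neg hk, if_neg hk, Nat.sub_zero, min_eq_left (hlight k (not_le.1 hk))]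
      exact mul_le_mul_of_nonneg_left (le_max_left _ _) (Nat.cast_nonneg _)
  have key := hC x 0 j hx1 hbudget
  exact key.trans (le_of_eq (Finset.sum_congr rfl fun W _ => by rw [zero_add]))

/-- **T-DIB ≡ the CORE step lemma**: `StepLemmaFSCore ↔ ∀ x < 1, DIBStar x`. [this work] -/
theorem stepLemmaFSCore_iff_dibStar : StepLemmaFSCore ↔ ∀ x : ℝ, x < 1 → DIBStar x :=
  ⟨fun H x hx => dibStar_of_stepLemmaFSCore H x hx, stepLemmaFSCore_of_dibStar⟩

/-- … hence the older typed forms follow from the core one: `StepLemmaFSCore → StepLemmaFS`. [this work] -/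
theorem stepLemmaFS_of_core (H : StepLemmaFSCore) : StepLemmaFS :=
  stepLemmaFS_of_dibStar (dibStar_of_stepLemmaFSCore H)

end IndepBlob

end Quant

end Summit.CriticalPhenomena.PercolationContinuityZ3.Theorems
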